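import Literature.NumberTheory.Sieve.HeathBrownCubicWindow
import Literature.NumberTheory.Sieve.HeathBrownCubicLemma111
import Literature.NumberTheory.LFunctions.CubeRootTwoFieldPID
import Literature.NumberTheory.Sieve.SieveFrameworkProofs
import HarnessLib

/-!
# Heath-Brown's Lemma 3.10, §11 pp. 66–68: from ideals `R, S` to generators `α, β`

Support for the proof of **Lemma 3.10** of D. R. Heath-Brown, *Primes represented by `x³ + 2y³`*,
Acta Math. 186 (2001), §11 "The proof of Lemma 3.10 — first steps" (pp. 66–68):

> "We write `∑_R c_R ∑_{RS ∈ 𝒜^(K), V < N(S) ≤ 2V} f_S = S_V` … where `x` is restricted to run over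
> primitive integer vectors. We shall call an integer of `K` 'primitive' if it has no rational prime
> factor … Thus `R` and `S` may be taken to belong to `𝒫` … We proceed to remove the condition that `x`
> is a primitive vector, by writing `S_V = ∑_{d ≪ X} μ(d) ∑_R c_R ∑_S f_S ∑_{d ∣ x, (x+y2^{1/3}) = RS} W(x)`.
> If `d > 1` then `(d, R) ≠ 1`, whence there is a prime ideal `P` dividing `d` for which `N(P) ≥ X^τ`.
> It follows that `d ≥ X^{τ/2}`. … We now replace `R` and `S` by their generators `α` and `β` … If we
> take `β` to run over a suitable set `Q'` of non-associated primitive integers of `K`, and require that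
> `x + y2^{1/3} = αβ`, then we will obtain exactly one value of `α` from each relevant set of associates."

This file PROVES the algebra behind these steps for the tree's objects (`bilin`, `divisorPairs`,
`boxPairs`, `pairElt`, `coordElt`), using the window generators of `HeathBrownCubicWindow` (our (11.3))
and the class number one of `K` (`CubeRootTwoFieldPID`):

* `winGen T I` — THE generator of the ideal `I ≠ 0` in the window `T < σ₁(β) ≤ E T`
  (`span_winGen`, `inWindow_winGen`, `winGen_span_of_inWindow`); `quo γ β` (exact quotient);
* `winDivs T γ` — the window generators of the divisors of `(γ)`, and **`sum_divisorPairs_eq_sum_winDivs`**: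
  `∑_{RS = (γ)} c_R d_S = ∑_{β ∈ winDivs T γ} c_{(γ/β)} d_{(β)}` ("replace `R` and `S` by their generators");
* `intCast_dvd_coordElt_iff` (`d ∣ β` in `ℤ[2^{1/3}]` iff `d` divides `β̂` componentwise),
  `pairElt_eq_coordElt`, **`isPrimitiveVec_of_dvd_pairElt`** (a divisor of `x + y·2^{1/3}`, `(x, y) = 1`,
  has primitive coordinate vector: "`R` and `S` may be taken to belong to `𝒫`");
* **`le_of_dvd_of_cR_ne_zero`** — the step "`d > 1 ⇒ (d, R) ≠ 1 ⇒ N(P) ≥ X^τ ⇒ d ≥ X^{τ/2}`", in the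
  sharper form `d ≥ X^τ`: if `d ≥ 2` divides `x` and `y`, `β ∣ x + y2^{1/3}` has primitive `β̂`, and
  `c_{(α)} ≠ 0` for `α = (x + y2^{1/3})/β` with `c` satisfying the support condition `CSupport` of (3.3)
  (values in `{0,1}`, `N(R)` square-free, `R` `X^τ`-rough), then every prime factor of `d` is `≥ X^τ`;
* `box X η` (the pairs `X < x, y ≤ X(1+η)` without the coprimality), `boxPairs_eq_filter_box`, and the
  Möbius inversion over the g.c.d. **`sum_filter_coprime_eq_sum_moebius`**:
  `∑_{(x,y)=1} h(x,y) = ∑_{d} μ(d) ∑_{d ∣ x, d ∣ y} h(x,y)`.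

## References

* D. R. Heath-Brown, *Primes represented by `x³ + 2y³`*, Acta Math. 186 (2001), 1–84: §11,
  pp. 66–68. [cite: HeathBrownActa2001, §11 pp. 66–68]
* G. Harman, *Prime-Detecting Sieves*, LMS Monographs 33 (2007), §13.8, pp. 278–279. [cite: Harman2007, §13.8]

## Mathlib / tree search

Mathlib: `ArithmeticFunction.moebius`, `Ideal.span_singleton_mul_span_singleton`,
`Ideal.span_singleton_le_span_singleton`, `mul_right_cancel₀` on `Ideal (𝓞 K)` (Dedekind),
`Ideal.exists_le_maximal`, `Nat.minFac`. Tree: `HeathBrownCubicWindow` (`InWindow`,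
`exists_associated_inWindow`, `eq_of_associated_of_inWindow`, `coordVec`), `CubeRootTwoFieldPID`
(`exists_eq_span_singleton`), `HeathBrownCubicLemma111` (`IsPrimitiveVec`, `DvdVec`),
`HeathBrownCubicTypeII` (`divisorPairs`, `idealDivisors`, `CSupport`), `HeathBrownCubicSieveSetup`
(`boxPairs`, `pairElt`, `IsRough`), `HeathBrownCubicSiegelWalfisz` (`absNorm_span_natCast_K`),
`SieveFrameworkProofs` (`sum_divisors_moebius_real`: `∑_{d ∣ n} μ(d) = [n = 1]`).
-/

noncomputable section

open Finset NumberField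

open scoped ArithmeticFunction.Moebius

namespace Literature.NumberTheory.Sieve.CubicSieve

open LFunctions.CubeRootTwoField CubicPrimes

/-! ### The window generator of an ideal -/

/-- Every nonzero ideal of `𝓞_K` has a generator in the window `T < σ₁(β) ≤ E T` (`T > 0`): class
number one and `exists_associated_inWindow`. [cite: HeathBrownActa2001, §11 p. 68] -/
theorem exists_eq_span_and_inWindow {T : ℝ} (hT : 0 < T) {I : Ideal (𝓞 K)} (hI : I ≠ ⊥) :
    ∃ β : 𝓞 K, I = Ideal.span {β} ∧ InWindow T β := by
  obtain ⟨β₀, rfl⟩ := exists_eq_span_singleton I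
  have hβ₀ : β₀ ≠ 0 := by intro h; apply hI; rw [h, Ideal.span_singleton_eq_bot]
  obtain ⟨u, hu⟩ := exists_associated_inWindow hT hβ₀
  refine ⟨(u : 𝓞 K) * β₀, ?_, hu⟩
  rw [Ideal.span_singleton_mul_left_unit (Units.isUnit u)]

/-- **`winGen T I`**: the generator of `I ≠ 0` lying in the window `T < σ₁(β) ≤ E T` (and `0` for
`I = 0` or `T ≤ 0`) — "a suitable set `Q'` of non-associated … integers of `K`" (p. 68).
[cite: HeathBrownActa2001, §11 p. 68] -/
def winGen (T : ℝ) (I : Ideal (𝓞 K)) : 𝓞 K :=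
  if h : 0 < T ∧ I ≠ ⊥ then (exists_eq_span_and_inWindow h.1 h.2).choose else 0

/-- `I = (winGen T I)` for `I ≠ 0`, `T > 0`. [cite: HeathBrownActa2001, §11 p. 68] -/
theorem span_winGen {T : ℝ} (hT : 0 < T) {I : Ideal (𝓞 K)} (hI : I ≠ ⊥) :
    Ideal.span {winGen T I} = I := by
  rw [winGen, dif_pos ⟨hT, hI⟩]
  exact (exists_eq_span_and_inWindow hT hI).choose_spec.1.symm

/-- `winGen T I` lies in the window. [cite: HeathBrownActa2001, §11 p. 68] -/
theorem inWindow_winGen {T : ℝ} (hT : 0 < T) {I : Ideal (𝓞 K)} (hI : I ≠ ⊥) :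
    InWindow T (winGen T I) := by
  rw [winGen, dif_pos ⟨hT, hI⟩]
  exact (exists_eq_span_and_inWindow hT hI).choose_spec.2

/-- `winGen T I ≠ 0` for `I ≠ 0`. [folklore] -/
theorem winGen_ne_zero {T : ℝ} (hT : 0 < T) {I : Ideal (𝓞 K)} (hI : I ≠ ⊥) : winGen T I ≠ 0 := by
  intro h
  have := span_winGen hT hI
  rw [h, Ideal.span_singleton_zero] at this
  exact hI this.symm

/-- `coordVec 0 = 0`. [folklore] -/
theorem coordVec_zero : coordVec (0 : 𝓞 K) = 0 := by
  apply coordElt_injective; rw [coordElt_coordVec]; simp [coordElt]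

/-- `σ₁(0) = 0`. [folklore] -/
theorem ellO_zero : ellO (0 : 𝓞 K) = 0 := by
  rw [ellO, coordVec_zero]; simp [castVec, ell]

/-- An element in a window (`T > 0`) is nonzero. [folklore] -/
theorem ne_zero_of_inWindow {T : ℝ} (hT : 0 < T) {β : 𝓞 K} (hβ : InWindow T β) : β ≠ 0 := by
  rintro rfl
  have h1 := hβ.1
  rw [ellO_zero] at h1
  linarith

/-- **Uniqueness**: a `β` in the window is THE window generator of `(β)` ("exactly one value … from
each relevant set of associates"). [cite: HeathBrownActa2001, §11 p. 68] -/
theorem winGen_span_of_inWindow {T : ℝ} (hT : 0 < T) {β : 𝓞 K} (hβ : InWindow T β) :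
    winGen T (Ideal.span {β}) = β := by
  have hβ0 : β ≠ 0 := ne_zero_of_inWindow hT hβ
  have hI : Ideal.span {β} ≠ ⊥ := by rwa [Ne, Ideal.span_singleton_eq_bot]
  have hspan := span_winGen hT hI
  rw [Ideal.span_singleton_eq_span_singleton] at hspan
  -- `winGen = β * u` for a unit `u`
  obtain ⟨u, hu⟩ := hspan.symm
  have hw : InWindow T ((u : 𝓞 K) * β) := by rw [mul_comm, hu]; exact inWindow_winGen hT hI
  rw [← hu, mul_comm]
  exact eq_of_associated_of_inWindow hT u hβ hw

/-! ### Exact quotients -/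

open scoped Classical in
/-- The exact quotient `γ/β` when `β ∣ γ` (and `0` otherwise). [folklore] -/
def quo (γ β : 𝓞 K) : 𝓞 K := if h : β ∣ γ then h.choose else 0

/-- `γ = β · (γ/β)` when `β ∣ γ`. [folklore] -/
theorem eq_mul_quo {γ β : 𝓞 K} (h : β ∣ γ) : γ = β * quo γ β := by
  classical
  rw [quo, dif_pos h]; exact h.choose_spec

/-- `(αβ)/β = α` (`β ≠ 0`). [folklore] -/
theorem quo_mul_self {α β : 𝓞 K} (hβ : β ≠ 0) : quo (α * β) β = α := by
  have h : β ∣ α * β := dvd_mul_left β α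
  have := eq_mul_quo h
  rw [mul_comm β] at this
  exact (mul_right_cancel₀ hβ this).symm

/-! ### Divisibility by rational integers and primitivity of coordinate vectors -/

/-- **`d ∣ β` in `ℤ[2^{1/3}]` iff `d` divides the coordinate vector `β̂` componentwise** (`{1, θ, θ²}`
is a `ℤ`-basis). [folklore] -/
theorem intCast_dvd_coordElt_iff (d : ℤ) (v : ℤ × ℤ × ℤ) : (d : 𝓞 K) ∣ coordElt v ↔ DvdVec d v := by
  constructor
  · rintro ⟨δ, hδ⟩
    obtain ⟨w, rfl⟩ := coordElt_surjective δ
    rw [← coordElt_smul] at hδ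
    have hv := coordElt_injective hδ
    rw [hv]
    exact ⟨⟨w.1, by simp⟩, ⟨w.2.1, by simp⟩, ⟨w.2.2, by simp⟩⟩
  · rintro ⟨⟨a, ha⟩, ⟨b, hb⟩, ⟨c, hc⟩⟩
    refine ⟨coordElt (a, b, c), ?_⟩
    rw [← coordElt_smul]
    congr 1
    ext <;> simp [ha, hb, hc]

/-- `x + y·2^{1/3} = coordElt (x, y, 0)`. [folklore] -/
theorem pairElt_eq_coordElt (xy : ℕ × ℕ) : pairElt xy = coordElt ((xy.1 : ℤ), (xy.2 : ℤ), 0) := by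
  simp [pairElt, coordElt]

/-- A non-unit integer dividing `β̂` componentwise contradicts primitivity. [folklore] -/
theorem not_isPrimitiveVec_of_dvdVec {d : ℤ} (hd : ¬ IsUnit d) {v : ℤ × ℤ × ℤ} (h : DvdVec d v) :
    ¬ IsPrimitiveVec v := fun hp => hd (hp d h.1 h.2.1 h.2.2)

/-- **Divisors of `x + y·2^{1/3}` with `(x, y) = 1` are primitive** ("In the case of `R` this is
automatic … `R` and `S` may be taken to belong to `𝒫`", p. 67): if `β ∣ x + y2^{1/3}` and
`gcd(x, y) = 1` then `β̂` is a primitive vector. [cite: HeathBrownActa2001, §11 p. 67] -/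
theorem isPrimitiveVec_of_dvd_pairElt {xy : ℕ × ℕ} (hxy : Nat.Coprime xy.1 xy.2) {β : 𝓞 K}
    (hβ : β ∣ pairElt xy) : IsPrimitiveVec (coordVec β) := by
  intro d h1 h2 h3
  have hdβ : (d : 𝓞 K) ∣ β := by
    rw [← coordElt_coordVec β]; exact (intCast_dvd_coordElt_iff d _).mpr ⟨h1, h2, h3⟩
  have hdγ : (d : 𝓞 K) ∣ coordElt ((xy.1 : ℤ), (xy.2 : ℤ), 0) := by
    rw [← pairElt_eq_coordElt]; exact hdβ.trans hβ
  rw [intCast_dvd_coordElt_iff] at hdγ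
  obtain ⟨hx, hy, -⟩ := hdγ
  have hg : d ∣ ((Int.gcd (xy.1 : ℤ) (xy.2 : ℤ) : ℕ) : ℤ) := Int.dvd_coe_gcd hx hy
  rw [Int.gcd_natCast_natCast, hxy.gcd_eq_one] at hg
  exact isUnit_of_dvd_one (by simpa using hg)

/-! ### The window divisors of `(γ)` and the passage from pairs of ideals to generators -/

open scoped Classical in
/-- **`winDivs T γ`**: the window generators of the nonzero divisors of `(γ)` — the values of `β` in
"`∑_{β} F_β ∑_{x + y2^{1/3} = αβ}`" attached to a given `x + y2^{1/3} = γ`. [cite: HeathBrownActa2001, §11 p. 68] -/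
def winDivs (T : ℝ) (γ : 𝓞 K) : Finset (𝓞 K) :=
  ((idealDivisors (Ideal.span {γ})).filter (· ≠ ⊥)).image (winGen T)

/-- Membership in `winDivs`: the `β` in the window dividing `γ`. [cite: HeathBrownActa2001, §11 p. 68] -/
theorem mem_winDivs_iff {T : ℝ} (hT : 0 < T) {γ : 𝓞 K} (hγ : γ ≠ 0) {β : 𝓞 K} :
    β ∈ winDivs T γ ↔ InWindow T β ∧ β ∣ γ := by
  classical
  have hI : Ideal.span {γ} ≠ ⊥ := by rwa [Ne, Ideal.span_singleton_eq_bot]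
  rw [winDivs, mem_image]
  constructor
  · rintro ⟨S, hS, rfl⟩
    rw [mem_filter, mem_idealDivisors_iff hI] at hS
    refine ⟨inWindow_winGen hT hS.2, ?_⟩
    have hle : Ideal.span {γ} ≤ S := Ideal.le_of_dvd hS.1
    rw [← span_winGen hT hS.2] at hle
    exact Ideal.mem_span_singleton.mp (hle (Ideal.mem_span_singleton_self γ))
  · rintro ⟨hw, hdvd⟩
    have hβ0 : β ≠ 0 := ne_zero_of_inWindow hT hw
    refine ⟨Ideal.span {β}, ?_, winGen_span_of_inWindow hT hw⟩
    rw [mem_filter, mem_idealDivisors_iff hI]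
    refine ⟨Ideal.dvd_iff_le.mpr (Ideal.span_singleton_le_span_singleton.mpr hdvd), ?_⟩
    rwa [Ne, Ideal.span_singleton_eq_bot]

/-- For a factorisation `R · S = (γ)`: with `β = winGen T S`, `S = (β)` and `R = (γ/β)`. [folklore] -/
theorem span_quo_winGen_eq {T : ℝ} (hT : 0 < T) {γ : 𝓞 K} (hγ : γ ≠ 0) {RS : Ideal (𝓞 K) × Ideal (𝓞 K)}
    (hRS : RS.1 * RS.2 = Ideal.span {γ}) :
    Ideal.span {winGen T RS.2} = RS.2 ∧ Ideal.span {quo γ (winGen T RS.2)} = RS.1 := by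
  have hI : Ideal.span {γ} ≠ ⊥ := by rwa [Ne, Ideal.span_singleton_eq_bot]
  have hS0 : RS.2 ≠ ⊥ := by
    intro h; apply hI; rw [← hRS, h, Ideal.mul_bot]
  have hspan := span_winGen hT hS0
  refine ⟨hspan, ?_⟩
  set β := winGen T RS.2 with hβ
  -- `β ∣ γ`
  have hle : Ideal.span {γ} ≤ RS.2 := Ideal.le_of_dvd ⟨RS.1, by rw [mul_comm, hRS]⟩
  rw [← hspan] at hle
  have hdvd : β ∣ γ := Ideal.mem_span_singleton.mp (hle (Ideal.mem_span_singleton_self γ))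
  have hq := eq_mul_quo hdvd
  -- `(γ/β) · (β) = (γ) = R · (β)`, cancel `(β) ≠ 0`
  have hSne : Ideal.span {β} ≠ ⊥ := by rw [hspan]; exact hS0
  apply mul_right_cancel₀ hSne
  rw [Ideal.span_singleton_mul_span_singleton, mul_comm (quo γ β), ← hq, hspan, hRS]

/-- **From pairs of ideals to generators** ("we now replace `R` and `S` by their generators `α` and
`β`, say … and require that `x + y2^{1/3} = αβ`", p. 68): for `γ ≠ 0` and any coefficients,
`∑_{R·S = (γ)} c_R d_S = ∑_{β ∈ winDivs T γ} c_{(γ/β)} d_{(β)}`. [cite: HeathBrownActa2001, §11 p. 68] -/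
theorem sum_divisorPairs_eq_sum_winDivs {T : ℝ} (hT : 0 < T) {γ : 𝓞 K} (hγ : γ ≠ 0)
    (c d : Ideal (𝓞 K) → ℝ) :
    ∑ RS ∈ divisorPairs (Ideal.span {γ}), c RS.1 * d RS.2 =
      ∑ β ∈ winDivs T γ, c (Ideal.span {quo γ β}) * d (Ideal.span {β}) := by
  classical
  have hI : Ideal.span {γ} ≠ ⊥ := by rwa [Ne, Ideal.span_singleton_eq_bot]
  refine Finset.sum_nbij' (fun RS => winGen T RS.2)
    (fun β => (Ideal.span {quo γ β}, Ideal.span {β})) ?_ ?_ ?_ ?_ ?_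
  · intro RS hRS
    rw [mem_divisorPairs_iff hI] at hRS
    have hS0 : RS.2 ≠ ⊥ := by intro h; apply hI; rw [← hRS, h, Ideal.mul_bot]
    rw [winDivs]
    refine mem_image_of_mem _ ?_
    rw [mem_filter, mem_idealDivisors_iff hI]
    exact ⟨⟨RS.1, by rw [mul_comm, hRS]⟩, hS0⟩
  · intro β hβ
    rw [mem_winDivs_iff hT hγ] at hβ
    rw [mem_divisorPairs_iff hI]
    simp only
    rw [Ideal.span_singleton_mul_span_singleton, mul_comm, ← eq_mul_quo hβ.2]
  · intro RS hRS
    rw [mem_divisorPairs_iff hI] at hRS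
    obtain ⟨h2, h1⟩ := span_quo_winGen_eq hT hγ hRS
    exact Prod.ext h1 h2
  · intro β hβ
    rw [mem_winDivs_iff hT hγ] at hβ
    exact winGen_span_of_inWindow hT hβ.1
  · intro RS hRS
    rw [mem_divisorPairs_iff hI] at hRS
    obtain ⟨h2, h1⟩ := span_quo_winGen_eq hT hγ hRS
    rw [h1, h2]

/-! ### "`d > 1 ⇒ (d, R) ≠ 1 ⇒ d ≥ X^τ`" -/

/-- **Heath-Brown's step "If `d > 1` then `(d, R) ≠ 1`, whence there is a prime ideal `P` dividing `d`
for which `N(P) ≥ X^τ`. It follows that `d ≥ X^{τ/2}`"** (p. 67), in the sharper form `d ≥ X^τ`: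
if `d ≥ 2` divides the integer vector `v`, `αβ = coordElt v` with `β̂` primitive, and `c_{(α)} ≠ 0`
for coefficients `c` as in (3.3) (`CSupport`: supported on `R` with `N(R)` square-free and all prime
factors of norm `≥ X^τ`), then `X^τ ≤ d`. (Any prime `p ∣ d` is not coprime to `α` — else `p ∣ β` —
so some prime `P ⊇ (p, α)` divides `(α)`; `N(P)` is a square-free divisor of `p³` exceeding `1`, i.e.
`N(P) = p`, and `N(P) ≥ X^τ`.) [cite: HeathBrownActa2001, §11 p. 67] -/
theorem rpow_le_of_dvdVec_of_ne_zero {X τ : ℝ} {c : Ideal (𝓞 K) → ℝ} (hc : CSupport X τ c) {d : ℕ}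
    (hd : 2 ≤ d) {v : ℤ × ℤ × ℤ} (hdv : DvdVec (d : ℤ) v) {α β : 𝓞 K} (hαβ : α * β = coordElt v)
    (hβ : IsPrimitiveVec (coordVec β)) (hcα : c (Ideal.span {α}) ≠ 0) : X ^ τ ≤ (d : ℝ) := by
  set p : ℕ := d.minFac with hp
  have hpp : p.Prime := Nat.minFac_prime (by omega)
  have hpd : p ∣ d := Nat.minFac_dvd d
  have hp2 : 2 ≤ p := hpp.two_le
  -- `p ∣ v` componentwise, so `(p) ∣ αβ`
  have hpv : DvdVec (p : ℤ) v := by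
    have h : (p : ℤ) ∣ (d : ℤ) := Int.natCast_dvd_natCast.mpr hpd
    exact ⟨h.trans hdv.1, h.trans hdv.2.1, h.trans hdv.2.2⟩
  have hpαβ : ((p : ℤ) : 𝓞 K) ∣ α * β := by
    rw [hαβ]; exact (intCast_dvd_coordElt_iff _ _).mpr hpv
  -- `p` and `α` are not coprime
  have hncop : ¬ IsCoprime ((p : ℤ) : 𝓞 K) α := by
    intro hcop
    have hpβ : ((p : ℤ) : 𝓞 K) ∣ β := hcop.dvd_of_dvd_mul_right (by rw [mul_comm] at hpαβ; exact hpαβ)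
    rw [← coordElt_coordVec β, intCast_dvd_coordElt_iff] at hpβ
    refine not_isPrimitiveVec_of_dvdVec ?_ hpβ hβ
    intro hu
    rcases Int.isUnit_iff.mp hu with h | h <;> omega
  -- a maximal ideal above `(p, α)`
  have hne : Ideal.span {((p : ℤ) : 𝓞 K)} ⊔ Ideal.span {α} ≠ ⊤ := by
    intro h
    apply hncop
    rw [← Ideal.isCoprime_span_singleton_iff, Ideal.isCoprime_iff_sup_eq, h]
  obtain ⟨P, hPmax, hPle⟩ := Ideal.exists_le_maximal _ hne
  have hPprime : P.IsPrime := hPmax.isPrime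
  have hPα : P ∣ Ideal.span {α} := Ideal.dvd_iff_le.mpr (le_sup_right.trans hPle)
  have hPp : P ∣ Ideal.span {((p : ℤ) : 𝓞 K)} := Ideal.dvd_iff_le.mpr (le_sup_left.trans hPle)
  -- the support condition
  obtain ⟨hsq, hrough⟩ := hc.2 _ hcα
  have hNP_ge : X ^ τ ≤ (Ideal.absNorm P : ℝ) := hrough hPprime hPα
  -- `N(P)` is a square-free divisor of `p³`, `> 1`, hence `= p`
  have hNP_dvd : Ideal.absNorm P ∣ p ^ 3 := by
    have := Ideal.absNorm_dvd_absNorm_of_le (Ideal.le_of_dvd hPp)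
    rwa [Int.cast_natCast, absNorm_span_natCast_K] at this
  have hNP_sq : Squarefree (Ideal.absNorm P) :=
    hsq.squarefree_of_dvd (Ideal.absNorm_dvd_absNorm_of_le (Ideal.le_of_dvd hPα))
  have hNP1 : Ideal.absNorm P ≠ 1 := by
    rw [Ne, Ideal.absNorm_eq_one_iff]; exact hPmax.ne_top
  obtain ⟨j, hj3, hj⟩ := (Nat.dvd_prime_pow hpp).mp hNP_dvd
  have hj1 : j = 1 := by
    rcases Nat.lt_or_ge j 2 with hlt | hge
    · interval_cases j
      · rw [pow_zero] at hj; exact absurd hj hNP1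
      · rfl
    · exfalso
      rw [hj] at hNP_sq
      have : p * p ∣ p ^ j := by
        rw [← sq]; exact pow_dvd_pow p hge
      exact hpp.not_isUnit (hNP_sq p this)
  rw [hj1, pow_one] at hj
  rw [hj] at hNP_ge
  calc X ^ τ ≤ (p : ℝ) := hNP_ge
    _ ≤ d := by exact_mod_cast Nat.minFac_le (by omega)

/-! ### The box of pairs and Möbius inversion over the g.c.d. -/

/-- The pairs `(x, y) ∈ ℕ²` with `X < x, y ≤ X(1+η)` (the support of Heath-Brown's `W(𝐱)`, p. 67,
without the coprimality defining `𝒜`). [cite: HeathBrownActa2001, §11 p. 67] -/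
def box (X η : ℝ) : Finset (ℕ × ℕ) :=
  {xy ∈ Iic ⌊X * (1 + η)⌋₊ ×ˢ Iic ⌊X * (1 + η)⌋₊ |
      X < xy.1 ∧ (xy.1 : ℝ) ≤ X * (1 + η) ∧ X < xy.2 ∧ (xy.2 : ℝ) ≤ X * (1 + η)}

/-- Membership in `box`: the bounding box is redundant. [cite: HeathBrownActa2001, §11 p. 67] -/
theorem mem_box_iff {X η : ℝ} {xy : ℕ × ℕ} :
    xy ∈ box X η ↔ X < xy.1 ∧ (xy.1 : ℝ) ≤ X * (1 + η) ∧ X < xy.2 ∧ (xy.2 : ℝ) ≤ X * (1 + η) := by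
  simp only [box, mem_filter, mem_product, mem_Iic, and_iff_right_iff_imp]
  rintro ⟨-, hx, -, hy⟩
  exact ⟨Nat.le_floor hx, Nat.le_floor hy⟩

/-- `𝒜`'s index set is the box with the coprimality condition: `W(𝐱)` with `𝐱` primitive.
[cite: HeathBrownActa2001, §11 p. 67] -/
theorem boxPairs_eq_filter_box (X η : ℝ) :
    boxPairs X η = (box X η).filter (fun xy => Nat.Coprime xy.1 xy.2) := by
  ext xy
  rw [mem_boxPairs_iff, mem_filter, mem_box_iff]
  tauto

/-- **Möbius inversion over the g.c.d.** ("we proceed to remove the condition that `𝐱` is a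
primitive vector, by writing `∑ = ∑_d μ(d) ∑_{d ∣ 𝐱}`", p. 67): for pairs of positive integers with
first coordinates `≤ D`, `∑_{(x,y)=1} h(x,y) = ∑_{d ≤ D} μ(d) ∑_{d ∣ x, d ∣ y} h(x,y)`.
[cite: HeathBrownActa2001, §11 p. 67] -/
theorem sum_filter_coprime_eq_sum_moebius (s : Finset (ℕ × ℕ)) (h : ℕ × ℕ → ℝ) {D : ℕ}
    (hpos : ∀ xy ∈ s, 1 ≤ xy.1) (hD : ∀ xy ∈ s, xy.1 ≤ D) :
    ∑ xy ∈ s.filter (fun xy => Nat.Coprime xy.1 xy.2), h xy =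
      ∑ d ∈ Icc 1 D, (μ d : ℝ) * ∑ xy ∈ s.filter (fun xy => d ∣ xy.1 ∧ d ∣ xy.2), h xy := by
  classical
  -- swap the sums
  have hswap : ∑ d ∈ Icc 1 D, (μ d : ℝ) * ∑ xy ∈ s.filter (fun xy => d ∣ xy.1 ∧ d ∣ xy.2), h xy =
      ∑ xy ∈ s, h xy * ∑ d ∈ (Icc 1 D).filter (fun d => d ∣ xy.1 ∧ d ∣ xy.2), (μ d : ℝ) := by
    simp only [sum_filter, mul_sum]
    rw [sum_comm]
    refine sum_congr rfl fun xy _ => ?_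
    refine sum_congr rfl fun d _ => ?_
    split_ifs <;> ring
  rw [hswap, sum_filter]
  refine sum_congr rfl fun xy hxy => ?_
  -- the inner sum is over the divisors of `gcd(x, y)`
  have hx1 := hpos xy hxy
  have hg0 : Nat.gcd xy.1 xy.2 ≠ 0 := by
    rw [Ne, Nat.gcd_eq_zero_iff]; omega
  have hset : (Icc 1 D).filter (fun d => d ∣ xy.1 ∧ d ∣ xy.2) = (Nat.gcd xy.1 xy.2).divisors := by
    ext d
    rw [mem_filter, mem_Icc, Nat.mem_divisors, Nat.dvd_gcd_iff]
    constructor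
    · rintro ⟨-, hd⟩; exact ⟨hd, hg0⟩
    · rintro ⟨hd, -⟩
      have hd1 : d ∣ xy.1 := hd.1
      have hdpos : 0 < d := Nat.pos_of_dvd_of_pos hd1 (by omega)
      exact ⟨⟨hdpos, (Nat.le_of_dvd (by omega) hd1).trans (hD xy hxy)⟩, hd⟩
  rw [hset, sum_divisors_moebius_real]
  by_cases hc : Nat.Coprime xy.1 xy.2
  · rw [if_pos hc, if_pos hc.gcd_eq_one, mul_one]
  · rw [if_neg hc, if_neg (by rwa [Nat.Coprime] at hc), mul_zero]

end Literature.NumberTheory.Sieve.CubicSieve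

end
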